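import Literature.MathematicalPhysics.QuantumFieldTheory.BalabanImbrieJaffe1984to88.BIJ85BlockAveragesTorus

/-!
# `BalabanImbrieJaffe1984to88.BIJ88Eq531TranslLaw` — T. Bałaban, J. Imbrie, A. Jaffe, *Effective action and cluster properties of the abelian
Higgs model*, Commun. Math. Phys. **114** (1988) 257–315 [BalabanImbrieJaffe1988], (3.24) p. 269 and (5.3.1)/(5.3.6) p. 280, with [2] =
[BalabanImbrieJaffe1985] (3.9)–(3.11) p. 307: **the first gauge-field translation `u = u′·(Q^{s*}v)` AT THE LEVEL OF THE MEASURE**, on the torus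
of record and without cut-off (the setting of *"chapter 6 of [2], where the effects of the translations are followed without the complications of
the large field regions"*, p. 280): under `𝒟u`, under `𝒟u δ_{Ax}(u)`, and under every probability law `ν` of `u` invariant under the substitutions
`u ↦ u·(Q^{s*}w)`, the pair `(u′, Qu)` is distributed as `law(u′) ⊗ dv` (`dv` = product Haar measure of the `L`-lattice), the substitution
`(u, v) ↦ u′·(Q^{s*}v)` is measure preserving `ν ⊗ dv → ν`, and `∫ν F(u) g(Qu) = ∫dv g(v) ∫ν F(u′·Q^{s*}v)` — the block field `v` is *"taken out
of the δ-functions"* `δ(v/Qu)` of the renormalization transformation.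

statement-level skeleton of published theorems with citation tags; proofs where landed; nothing here is a claim about the Yang–Mills mass gap

PDF held: `paper:balaban1988-cmp114-bij-abelian-higgs-effective-action` (journal page = PDF page + 256); p. 269 [PDF 13] read as an image
(CCITT-G4 ×2 render `renders/original-p013-x2.png` of this seat, made with ref-1's `g4png.py`), p. 280 [PDF 24] (r16's render
`HOME/lit-balaban-r16/renders/cmp114/original-p024-x2.png`); [BalabanImbrieJaffe1985] p. 307 [PDF 9] as quoted verbatim in p03's
`BIJ85Eq311Proof` and r18's `BIJ85BlockAveragesTorus.uPrime`.

CITATION HEADER (lean-in-tree rule).  Part of the lit-balaban TYPED SKELETON (HOME `run/shared/lean/pub/lit-balaban/`), PHASE-2 proof seat p34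
gen 7 (unit `lit-balaban-p34-g7`; TAKING line HOME/STATUS.md 2026-08-21T11:21:25Z, free-target protocol G.5-34(d), own lineage = the C1/C2
renormalization-transformation line, gen-6 hand-off item (iii)).  Rows served (support): `C2.Eq3.24` of `HOME/lit-balaban-r18/ROWS-C2.md`
(owner r18), `C2.Eq5.3.1-5.3.7` of `HOME/lit-balaban-r16/ROWS-C2-part2.md` (owner r16), xref `C1.Eq3.9-3.12` of `HOME/lit-balaban-r15/ROWS-C1.md`
(owner r15).

THE PRINTED TEXT (verbatim).  p. 269 [PDF 13]: *"We begin with a translation of the gauge field which takes the block field v out of the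
δ-functions of the renormalization transformation. Thus we put u_b = u′_bu_{b′}, if b ∈ B^s(b′) ∩ Λ₁^{(0)*}, u′_b, otherwise. ≡
u′_b(Λ₁^{(0)*}Q^{s*}v)_b, (3.24) where the prefactor Λ₁^{(0)*} indicates that what follows is present only for b ∈ Λ₁^{(0)*}. From the
restrictions on the fields, we have that u′_b = e^{ie₀A′_b}, with |A′_b| ≦ cp(e₀) in Λ₁^{(0)*}. The axial gauge δ-functions are invariant under
this translation. In Λ₁^{(0)}, δ(v/Qu) becomes proportional to δ(QA′). In the general step, a gauge transformation is needed at this point.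
However, it is unnecessary here."*  p. 280 [PDF 24]: *"5.3. First Gauge Field Translation. The first translation is done in Λ₁^{(k)*}, and it
removes the v-field from the δ-functions there. As in (3.24) we put u = u′(Λ₁^{(k)*}Q^{s*}v), (5.3.1) cf. also (I.6.2). (The reader may wish to
refer to chapter 6 of [2], where the effects of the translations are followed without the complications of the large field regions.) … The
translation affects the δ-functions as follows. δ_{Ax}(u) = δ_{Ax}(u′), δ(v/Qu) = δ_{Λ₁^{(k)′*c}}(v/Qu) δ_{Λ₁^{(k)′*}}((e_k/2π)QA′), (5.3.6)"*.
[2] p. 307 [PDF 9]: *"First define a unit lattice field u′_b with block averages equal to 1. … Let (u′)_b = u_b, if b ∉ B^s(b′), u_bv_{b′}^{−1},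
if b ∈ B^s(b′) (3.9) be given in terms of the averaging operator Q of (2.10), where v_{b′} = (Qu)_{b′}. (3.10) It then follows that (Qu′)_{b′} =
1 (3.11) for all L-lattice bonds b′."*

THE READING (all carriers of record; nothing re-declared).  Unit lattice `T₁^{(k)}` = torus level `j` of `Balaban1983to89.Setup` (standing range
`j + 1 ≤ m + K`), `L`-lattice = level `j + 1`; `U(1) = BIJ88Sect3Statements.U1`; `𝒟u = fieldMeasure P j U1` and `dv = fieldMeasure P (j+1) U1`
(product Haar probability measures), `𝒟u δ_{Ax}(u)` = r18's `BIJ88RenormTransf311.axialMeasure` ((3.4) on the torus); `Q` = (2.10)–(2.11) of [2]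
= r18's `BIJ85BlockAveragesTorus.qU`; the substitution `u·(Q^{s*}w)` = r18's `surfMul u w` (`surfFactor w` = the group-valued `Q^{s*}w` of [2]
(4.5.2): `w_{b′}` on the surface bonds `B^s(b′)`, `1` elsewhere — p31's `BIJ88Eq536Linearization.toC_transl_eq_transl531`/`toC_transl_eq_u324`
identify `surfMul u′ (cutoff Λ v)` with r16's typed (5.3.1) `transl531` and r18's typed (3.24) `u324`); `u′` = [2] (3.9)–(3.10) = r18's `uPrime u =
surfMul u (Qu)⁻¹`.  WITHOUT CUT-OFF means `Λ₁^{(k)*}` = all unit-lattice bonds (the whole torus small-field), so that no factor `δ_{Λ′*c}(v/Qu)` is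
left in (5.3.6) — the [2]-chapter-6 setting the paper points to.  The cut-off translation and the CONSTRAINT-SET content of (5.3.6)–(5.3.7) bond
by bond are p31's `BIJ88Eq536Linearization` §4 (`deltaAx_surfMul_iff`, `qU_transl_of_mem`/`qU_transl_of_not_mem`, `eq537`); the factor `e_k/2π`
is p31's `BIJ88Eq537Jacobian`; the marginal statement `law(Qu) = dv` is r18's `map_qU_eq_of_invariant`/`map_qU_fieldMeasure`/`map_qU_axialMeasure`.

WHAT IS PROVED (kernel-checked; theorems only, no `def`, no `Prop`-valued fact; standard axioms).
* §1 ALGEBRA OF THE SUBSTITUTION: `surfMul_surfMul` (`(u·Q^{s*}w)·Q^{s*}w′ = u·Q^{s*}(ww′)`), `surfMul_one`, **`uPrime_surfMul`** (`(u·Q^{s*}w)′ =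
  u′`: the new variable does not see `w`), **`surfMul_uPrime_qU`** (`u = u′·Q^{s*}(Qu)`: (3.24)/(5.3.1) solved by the pair `(u′, v = Qu)`),
  **`qU_surfMul_uPrime`** (`Q(u′·Q^{s*}v) = v`: after the translation `δ(v/Qu)` is identically satisfied — r18's (3.11) `qU_uPrime` with
  `qU_surfMul`), and the measurability of `(u, w) ↦ u·Q^{s*}w`, `u ↦ u′`, `u ↦ (u′, Qu)`.
* §2 INVARIANT LAWS: `axialMeasure_map_surfMul` — `𝒟u δ_{Ax}(u)` is invariant under every substitution (r18's `map_surfMul_map_fixBonds`; the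
  measure form of *"δ_{Ax}(u) = δ_{Ax}(u′)"* / *"The axial gauge δ-functions are invariant under this translation"*; for `𝒟u` r18's
  `map_surfMul_fieldMeasure`); `lintegral_comp_surfMul`.
* §3 **THE JOINT LAW** for a probability law `ν` with `(·Q^{s*}w)_*ν = ν` for all `w`: `lintegral_qU_eq_lintegral_lintegral` (`∫ν J(u, Qu) =
  ∫ν ∫dv J(u, v)` for jointly measurable `J ≥ 0` with `J(u·Q^{s*}w, ·) = J(u, ·)`: average over `w` against Haar, Tonelli, `Q(u·Q^{s*}w) = (Qu)·w`)
  and **`map_graph_eq_prod`: `law(u′, Qu) = law(u′) ⊗ dv`** — `u′` and `v = Qu` are INDEPENDENT, `v` Haar distributed.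
* §4 MEASURE-PRESERVING FORMS: `measurePreserving_graph` (`u ↦ (u′, Qu)`), `map_surfMul_prod`, **`measurePreserving_transl`** (`(u, v) ↦
  u′·Q^{s*}v` carries `ν ⊗ dv` onto `ν`).
* §5 INTEGRALS: `lintegral_eq_transl`, **`integral_eq_transl`** (`∫ν F = ∫ν ∫dv F(u′·Q^{s*}v)`) and **`integral_mul_comp_qU_eq_transl`**:
  `∫ν F(u) g(Qu) = ∫dv g(v) ∫ν F(u′·Q^{s*}v)` for `ν`-integrable `F` and bounded measurable `g` — the test-function form of *"takes the block
  field v out of the δ-functions"*: integrated against `δ(v/Qu)`, the `u`-integral of `F` is the `ν`-integral of `F` over the translated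
  fibre `u′·Q^{s*}v`.
* §6 THE INSTANCES OF RECORD `ν = 𝒟u` / `ν = 𝒟u δ_{Ax}(u)`: `map_graph_fieldMeasure`, `map_graph_axialMeasure`, `integral_fieldMeasure_eq_transl`,
  `integral_axialMeasure_eq_transl`, `integral_mul_comp_qU_axialMeasure` (hypothesis-free but for the standing range).
The companion file `BIJ88Eq531TranslDensity` (same seat) applies §§3–6 to the densities of (3.11)/(5.1.1) constructed in this seat's gens 2–6.
NOT DONE HERE (honest scope).  A cut-off `Λ₁^{(k)*}` other than all bonds (large-field regions: the partial translation removes only the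
`Λ₁^{(k)′*}`-components of `v` from the δ-functions); the description of `law(u′)` in the variables `A′` of (3.12)/(5.3.6)–(5.3.7)
(`δ((e_k/2π)QA′)`, Jacobian `e_k/2π`: p31's files); the gauge transformation *"needed at this point"* in the general step ((5.2.9): r16, and this
seat's `BIJ88RT51BlockGauge`); bounds of any kind.  Imports r18's `BIJ85BlockAveragesTorus` only (Literature + Mathlib); re-declares nothing.
-/

namespace Literature.MathematicalPhysics.QuantumFieldTheory.BalabanImbrieJaffe1984to88.BIJ88Eq531TranslLaw

open Literature.MathematicalPhysics.QuantumFieldTheory.Balaban1983to89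
open BIJ88Sect3Statements (U1)
open BIJ88RenormTransf311 (axialMeasure)
open BIJ85BlockAveragesTorus (qU IsCross coarse surfFactor surfMul uPrime qU_surfMul qU_uPrime measurable_qU measurable_surfMul
  map_surfMul_fieldMeasure map_surfMul_map_fixBonds surfMul_of_isCross surfMul_of_not_isCross)
open scoped BigOperators ENNReal
open _root_.MeasureTheory _root_.MeasureTheory.Measure Function

noncomputable section

variable {P : Params} {j : ℕ}

/-! ## §1 Algebra of the substitution `u·Q^{s*}w` and of `u′` -/

/-- kernel: r18's group-valued `Q^{s*}w` unfolded — `w_{b′}` on the surface bonds `b ∈ B^s(b′)`, `1` elsewhere. [cite: BalabanImbrieJaffe1985, (3.9) p.307] -/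
theorem surfFactor_apply (w : GaugeField P (j+1) U1) (b : PBond P j) :
    surfFactor w b = if IsCross b then w (coarse b) else 1 := rfl

/-- kernel: `Q^{s*}` is multiplicative, `Q^{s*}(ww′) = Q^{s*}w·Q^{s*}w′` ([2] (4.5.3) for the group-valued pull-back; cf. p31's `BIJ88Eq533Torus.qsstarG_mul`). [cite: BalabanImbrieJaffe1985, (3.9) p.307] -/
theorem surfFactor_mul (w w' : GaugeField P (j+1) U1) (b : PBond P j) :
    surfFactor (fun c => w c * w' c) b = surfFactor w b * surfFactor w' b := by
  by_cases hb : IsCross b <;> simp [surfFactor_apply, hb]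

/-- **two substitutions compose**: `(u·Q^{s*}w)·Q^{s*}w′ = u·Q^{s*}(ww′)`. [cite: BalabanImbrieJaffe1988, (3.24) p.269] -/
theorem surfMul_surfMul (U : GaugeField P j U1) (w w' : GaugeField P (j+1) U1) :
    surfMul (surfMul U w) w' = surfMul U (fun c => w c * w' c) := by
  funext b
  simp only [surfMul, surfFactor_mul, mul_assoc]

/-- kernel: the trivial substitution, `u·Q^{s*}1 = u`. [cite: BalabanImbrieJaffe1988, (3.24) p.269] -/
theorem surfMul_one (U : GaugeField P j U1) : surfMul U (fun _ => 1) = U := by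
  funext b
  by_cases hb : IsCross b
  · rw [surfMul_of_isCross _ _ hb, mul_one]
  · rw [surfMul_of_not_isCross _ _ hb]

/-- kernel: r18's `u′` unfolded — [2] (3.9)–(3.10) `u′ = u·Q^{s*}((Qu)⁻¹)`. [cite: BalabanImbrieJaffe1985, (3.9) p.307] -/
theorem uPrime_eq (U : GaugeField P j U1) : uPrime U = surfMul U (fun c => (qU U c)⁻¹) := rfl

/-- **`(u·Q^{s*}w)′ = u′`** — the variable `u′` of (3.24)/(5.3.1) does not see the substituted block field: `Q(u·Q^{s*}w) = (Qu)·w`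
(r18's `qU_surfMul`) and `w·((Qu)·w)⁻¹ = (Qu)⁻¹` (standing range). [cite: BalabanImbrieJaffe1988, (5.3.1) p.280] -/
theorem uPrime_surfMul (hj : j + 1 ≤ P.m + P.K) (U : GaugeField P j U1) (w : GaugeField P (j+1) U1) :
    uPrime (surfMul U w) = uPrime U := by
  rw [uPrime_eq, uPrime_eq, surfMul_surfMul, qU_surfMul hj]
  congr 1
  funext c
  show w c * (qU U c * w c)⁻¹ = (qU U c)⁻¹
  rw [mul_inv_rev, mul_inv_cancel_left]

/-- **(3.24)/(5.3.1) solved by the pair `(u′, v) = (u′(u), Qu)`: `u = u′·Q^{s*}(Qu)`** ([2] (3.9): `u′·Q^{s*}v` undoes the division by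
`v_{b′}` on the surface bonds). [cite: BalabanImbrieJaffe1988, (5.3.1) p.280] -/
theorem surfMul_uPrime_qU (U : GaugeField P j U1) : surfMul (uPrime U) (qU U) = U := by
  rw [uPrime_eq, surfMul_surfMul]
  conv_rhs => rw [← surfMul_one U]
  congr 1
  funext c
  exact inv_mul_cancel (qU U c)

/-- kernel: the substitution `(u, w) ↦ u·Q^{s*}w` is jointly measurable. [cite: BalabanImbrieJaffe1988, (3.24) p.269] -/
theorem measurable_surfMul₂ :
    Measurable fun p : GaugeField P j U1 × GaugeField P (j+1) U1 => surfMul p.1 p.2 := by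
  refine measurable_pi_iff.mpr fun b => ?_
  by_cases hb : IsCross b
  · simp only [surfMul, surfFactor_apply, if_pos hb]
    exact ((measurable_pi_apply b).comp measurable_fst).mul ((measurable_pi_apply (coarse b)).comp measurable_snd)
  · simp only [surfMul, surfFactor_apply, if_neg hb, mul_one]
    exact (measurable_pi_apply b).comp measurable_fst

/-- kernel: `u ↦ u′` is measurable (through r18's `measurable_qU`). [cite: BalabanImbrieJaffe1985, (3.9) p.307] -/
theorem measurable_uPrime : Measurable (uPrime : GaugeField P j U1 → GaugeField P j U1) := by
  have h1 : Measurable fun U : GaugeField P j U1 => (U, fun c => (qU U c)⁻¹) :=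
    measurable_id.prodMk (measurable_pi_iff.mpr fun c => ((measurable_pi_apply c).comp measurable_qU).inv)
  exact measurable_surfMul₂.comp h1

/-- kernel: `u ↦ (u′, Qu)` is measurable. [cite: BalabanImbrieJaffe1985, (3.9) p.307] -/
theorem measurable_graph : Measurable fun U : GaugeField P j U1 => (uPrime U, qU U) :=
  measurable_uPrime.prodMk measurable_qU


/-- **`Q(u′·Q^{s*}v) = v`**: after the translation (3.24)/(5.3.1) the δ-function `δ(v/Qu)` is identically satisfied in the new variables —
[2] (3.11) `Qu′ = 1` (r18's `qU_uPrime`) and `Q(u′·Q^{s*}v) = (Qu′)·v` (r18's `qU_surfMul`); p. 280 *"it removes the v-field from the δ-functions"*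
(standing range). [cite: BalabanImbrieJaffe1988, (5.3.1) p.280] -/
theorem qU_surfMul_uPrime (hj : j + 1 ≤ P.m + P.K) (U : GaugeField P j U1) (v : GaugeField P (j+1) U1) :
    qU (surfMul (uPrime U) v) = v := by
  rw [qU_surfMul hj, qU_uPrime hj]
  funext c
  exact one_mul (v c)

/-! ## §2 Substitution-invariant laws -/

/-- kernel: under a law invariant under the substitution by `w`, `∫ν F(u·Q^{s*}w) = ∫ν F(u)` (`F ≥ 0` measurable). [cite: BalabanImbrieJaffe1988, (5.3.1) p.280] -/
theorem lintegral_comp_surfMul {ν : Measure (GaugeField P j U1)} (hν : ∀ w, ν.map (fun U => surfMul U w) = ν)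
    (w : GaugeField P (j+1) U1) {F : GaugeField P j U1 → ℝ≥0∞} (hF : Measurable F) :
    ∫⁻ U, F (surfMul U w) ∂ν = ∫⁻ U, F U ∂ν := by
  rw [← lintegral_map hF (measurable_surfMul w), hν w]

/-- **`𝒟u δ_{Ax}(u)` is invariant under every substitution `u ↦ u·Q^{s*}w`** — the measure form of p. 280 *"δ_{Ax}(u) = δ_{Ax}(u′)"* /
p. 269 *"The axial gauge δ-functions are invariant under this translation"* (surface bonds are not tree bonds: r18's `map_surfMul_map_fixBonds`;
the constraint form is p31's `BIJ88Eq536Linearization.deltaAx_surfMul_iff`).  For `𝒟u` itself: r18's `map_surfMul_fieldMeasure`.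
[cite: BalabanImbrieJaffe1988, (5.3.6) p.280] -/
theorem axialMeasure_map_surfMul (w : GaugeField P (j+1) U1) :
    (axialMeasure P j U1).map (fun U => surfMul U w) = axialMeasure P j U1 := by
  unfold axialMeasure
  exact map_surfMul_map_fixBonds w

/-! ## §3 The joint law of `(u′, Qu)` -/

/-- **AVERAGING OUT THE BLOCK FIELD.**  For a probability law `ν` of `u` invariant under all substitutions `u ↦ u·Q^{s*}w` and a jointly
measurable `J(u, v) ≥ 0` that does not see the substitution in its first argument (`J(u·Q^{s*}w, ·) = J(u, ·)`):
`∫ν J(u, Qu) = ∫ν ∫dv J(u, v)`.  Proof: `dv` is invariant under `v ↦ (Qu)·v` (left translation on the compact group, the tree's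
`AveragingRT.measurePreserving_mulLeft`), Tonelli, `Q(u·Q^{s*}w) = (Qu)·w` (r18's `qU_surfMul`) and the invariance of `ν` and of `J`;
`ν` a probability measure (standing range). [cite: BalabanImbrieJaffe1988, (5.3.1) p.280] -/
theorem lintegral_qU_eq_lintegral_lintegral (hj : j + 1 ≤ P.m + P.K) {ν : Measure (GaugeField P j U1)} [IsProbabilityMeasure ν]
    (hν : ∀ w, ν.map (fun U => surfMul U w) = ν)
    {J : GaugeField P j U1 → GaugeField P (j+1) U1 → ℝ≥0∞} (hJ : Measurable (uncurry J))
    (hJinv : ∀ U w, J (surfMul U w) = J U) :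
    ∫⁻ U, J U (qU U) ∂ν = ∫⁻ U, ∫⁻ v, J U v ∂fieldMeasure P (j+1) U1 ∂ν := by
  have hJU : ∀ U, Measurable (J U) := fun U => hJ.comp measurable_prodMk_left
  have hm1 : Measurable fun p : GaugeField P j U1 × GaugeField P (j+1) U1 => J p.1 (fun c => qU p.1 c * p.2 c) := by
    have h : Measurable fun p : GaugeField P j U1 × GaugeField P (j+1) U1 => (p.1, fun c => qU p.1 c * p.2 c) :=
      measurable_fst.prodMk (measurable_pi_iff.mpr fun c =>
        ((measurable_pi_apply c).comp (measurable_qU.comp measurable_fst)).mul ((measurable_pi_apply c).comp measurable_snd))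
    exact hJ.comp h
  have hm2 : Measurable fun U : GaugeField P j U1 => J U (qU U) := hJ.comp (measurable_id.prodMk measurable_qU)
  symm
  calc ∫⁻ U, ∫⁻ v, J U v ∂fieldMeasure P (j+1) U1 ∂ν
      = ∫⁻ U, ∫⁻ w, J U (fun c => qU U c * w c) ∂fieldMeasure P (j+1) U1 ∂ν := by
        refine lintegral_congr fun U => ?_
        exact ((AveragingRT.measurePreserving_mulLeft (P := P) (j := j+1) (G := U1) (qU U)).lintegral_comp (hJU U)).symm
    _ = ∫⁻ w, ∫⁻ U, J U (fun c => qU U c * w c) ∂ν ∂fieldMeasure P (j+1) U1 :=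
        lintegral_lintegral_swap hm1.aemeasurable
    _ = ∫⁻ w, ∫⁻ U, J (surfMul U w) (qU (surfMul U w)) ∂ν ∂fieldMeasure P (j+1) U1 := by
        refine lintegral_congr fun w => lintegral_congr fun U => ?_
        rw [qU_surfMul hj, hJinv]
    _ = ∫⁻ w, ∫⁻ U, J U (qU U) ∂ν ∂fieldMeasure P (j+1) U1 := by
        refine lintegral_congr fun w => ?_
        exact lintegral_comp_surfMul hν w hm2
    _ = ∫⁻ U, J U (qU U) ∂ν := by
        rw [lintegral_const, measure_univ, mul_one]

/-- **THE JOINT LAW OF `(u′, Qu)`: `law(u′, Qu) = law(u′) ⊗ dv`.**  Under every probability law `ν` of the unit-lattice field invariant under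
the substitutions `u ↦ u·Q^{s*}w` (`𝒟u`: r18's `map_surfMul_fieldMeasure`; `𝒟u δ_{Ax}(u)`: `axialMeasure_map_surfMul`) the new variable `u′` of
(3.24)/(5.3.1) and the block field `v = Qu` are INDEPENDENT and `v` is distributed by the product Haar measure `dv` of the `L`-lattice — the
measure-level content of *"takes the block field v out of the δ-functions of the renormalization transformation"* (p. 269) on the whole torus
(`lintegral_qU_eq_lintegral_lintegral` on indicators, with `(u·Q^{s*}w)′ = u′`; r18's `map_qU_eq_of_invariant` is the second marginal). [cite: BalabanImbrieJaffe1988, (5.3.1) p.280] -/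
theorem map_graph_eq_prod (hj : j + 1 ≤ P.m + P.K) {ν : Measure (GaugeField P j U1)} [IsProbabilityMeasure ν]
    (hν : ∀ w, ν.map (fun U => surfMul U w) = ν) :
    ν.map (fun U => (uPrime U, qU U)) = (ν.map uPrime).prod (fieldMeasure P (j+1) U1) := by
  haveI : IsProbabilityMeasure (ν.map (uPrime : GaugeField P j U1 → GaugeField P j U1)) :=
    Measure.isProbabilityMeasure_map measurable_uPrime.aemeasurable
  ext S hS
  rw [Measure.map_apply measurable_graph hS, Measure.prod_apply hS,
    lintegral_map (measurable_measure_prodMk_left hS) measurable_uPrime, ← lintegral_indicator_one (measurable_graph hS)]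
  have e1 : ∀ U : GaugeField P j U1, ((fun U => (uPrime U, qU U)) ⁻¹' S).indicator (1 : GaugeField P j U1 → ℝ≥0∞) U =
      S.indicator 1 (uPrime U, qU U) := fun U => rfl
  have e2 : ∀ U : GaugeField P j U1, fieldMeasure P (j+1) U1 (Prod.mk (uPrime U) ⁻¹' S) =
      ∫⁻ v, S.indicator 1 (uPrime U, v) ∂fieldMeasure P (j+1) U1 := fun U => by
    rw [← lintegral_indicator_one (measurable_prodMk_left hS)]
    rfl
  simp_rw [e1, e2]
  refine lintegral_qU_eq_lintegral_lintegral hj hν (J := fun U v => S.indicator 1 (uPrime U, v)) ?_ ?_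
  · exact (measurable_const.indicator hS).comp ((measurable_uPrime.comp measurable_fst).prodMk measurable_snd)
  · intro U w
    funext v
    rw [uPrime_surfMul hj]

/-! ## §4 The translation as a measure-preserving map -/

/-- `u ↦ (u′, Qu)` is measure preserving `ν → law(u′) ⊗ dv` (`map_graph_eq_prod`). [cite: BalabanImbrieJaffe1988, (5.3.1) p.280] -/
theorem measurePreserving_graph (hj : j + 1 ≤ P.m + P.K) {ν : Measure (GaugeField P j U1)} [IsProbabilityMeasure ν]
    (hν : ∀ w, ν.map (fun U => surfMul U w) = ν) :
    MeasurePreserving (fun U => (uPrime U, qU U)) ν ((ν.map uPrime).prod (fieldMeasure P (j+1) U1)) :=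
  ⟨measurable_graph, map_graph_eq_prod hj hν⟩

/-- kernel: the substitution pushes `law(u′) ⊗ dv` back to `ν` (`u′·Q^{s*}(Qu) = u`). [cite: BalabanImbrieJaffe1988, (5.3.1) p.280] -/
theorem map_surfMul_prod (hj : j + 1 ≤ P.m + P.K) {ν : Measure (GaugeField P j U1)} [IsProbabilityMeasure ν]
    (hν : ∀ w, ν.map (fun U => surfMul U w) = ν) :
    ((ν.map uPrime).prod (fieldMeasure P (j+1) U1)).map (fun p => surfMul p.1 p.2) = ν := by
  rw [← map_graph_eq_prod hj hν, Measure.map_map measurable_surfMul₂ measurable_graph]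
  have e : (fun p : GaugeField P j U1 × GaugeField P (j+1) U1 => surfMul p.1 p.2) ∘ (fun U => (uPrime U, qU U)) = id :=
    funext fun U => surfMul_uPrime_qU U
  rw [e, Measure.map_id]

/-- **THE TRANSLATION IS MEASURE PRESERVING: `(u, v) ↦ u′(u)·Q^{s*}v` carries `ν ⊗ dv` onto `ν`** for every substitution-invariant probability
law `ν` (`𝒟u`, `𝒟u δ_{Ax}(u)`): integrating `du` against `ν` is integrating `du dv` after the change of variables (3.24)/(5.3.1) with `u′ = u′(u)`
(`map_graph_eq_prod` composed with the substitution). [cite: BalabanImbrieJaffe1988, (5.3.1) p.280] -/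
theorem measurePreserving_transl (hj : j + 1 ≤ P.m + P.K) {ν : Measure (GaugeField P j U1)} [IsProbabilityMeasure ν]
    (hν : ∀ w, ν.map (fun U => surfMul U w) = ν) :
    MeasurePreserving (fun p : GaugeField P j U1 × GaugeField P (j+1) U1 => surfMul (uPrime p.1) p.2)
      (ν.prod (fieldMeasure P (j+1) U1)) ν := by
  have h1 : MeasurePreserving (Prod.map uPrime id : GaugeField P j U1 × GaugeField P (j+1) U1 → _)
      (ν.prod (fieldMeasure P (j+1) U1)) ((ν.map uPrime).prod (fieldMeasure P (j+1) U1)) :=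
    (⟨measurable_uPrime, rfl⟩ : MeasurePreserving uPrime ν (ν.map uPrime)).prod (MeasurePreserving.id _)
  have h2 : MeasurePreserving (fun p : GaugeField P j U1 × GaugeField P (j+1) U1 => surfMul p.1 p.2)
      ((ν.map uPrime).prod (fieldMeasure P (j+1) U1)) ν :=
    ⟨measurable_surfMul₂, map_surfMul_prod hj hν⟩
  exact h2.comp h1

/-! ## §5 Integrals after the translation -/

/-- **`∫ν F(u) = ∫ν ∫dv F(u′·Q^{s*}v)`** for measurable `F ≥ 0` (`measurePreserving_transl` + Tonelli). [cite: BalabanImbrieJaffe1988, (5.3.1) p.280] -/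
theorem lintegral_eq_transl (hj : j + 1 ≤ P.m + P.K) {ν : Measure (GaugeField P j U1)} [IsProbabilityMeasure ν]
    (hν : ∀ w, ν.map (fun U => surfMul U w) = ν) {F : GaugeField P j U1 → ℝ≥0∞} (hF : Measurable F) :
    ∫⁻ U, F U ∂ν = ∫⁻ U, ∫⁻ v, F (surfMul (uPrime U) v) ∂fieldMeasure P (j+1) U1 ∂ν := by
  rw [← (measurePreserving_transl hj hν).lintegral_comp hF]
  exact lintegral_prod _ (hF.comp (measurePreserving_transl hj hν).measurable).aemeasurable

/-- **`∫ν F(u) = ∫ν ∫dv F(u′·Q^{s*}v)`** for a `ν`-integrable `F` with values in a real Banach space (`measurePreserving_transl` + Fubini):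
the `u`-integral of the renormalization transformation rewritten in the translated variables of (3.24)/(5.3.1), whole torus. [cite: BalabanImbrieJaffe1988, (5.3.1) p.280] -/
theorem integral_eq_transl (hj : j + 1 ≤ P.m + P.K) {ν : Measure (GaugeField P j U1)} [IsProbabilityMeasure ν]
    (hν : ∀ w, ν.map (fun U => surfMul U w) = ν) {E : Type*} [NormedAddCommGroup E] [NormedSpace ℝ E]
    {F : GaugeField P j U1 → E} (hF : Integrable F ν) :
    ∫ U, F U ∂ν = ∫ U, ∫ v, F (surfMul (uPrime U) v) ∂fieldMeasure P (j+1) U1 ∂ν := by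
  have hΨ := measurePreserving_transl hj hν
  have hI : Integrable (fun p : GaugeField P j U1 × GaugeField P (j+1) U1 => F (surfMul (uPrime p.1) p.2))
      (ν.prod (fieldMeasure P (j+1) U1)) :=
    (hΨ.integrable_comp hF.aestronglyMeasurable).2 hF
  have h1 : ∫ U, F U ∂ν = ∫ p, F (surfMul (uPrime p.1) p.2) ∂ν.prod (fieldMeasure P (j+1) U1) := by
    have hF' : AEStronglyMeasurable F (Measure.map (fun p : GaugeField P j U1 × GaugeField P (j+1) U1 =>
        surfMul (uPrime p.1) p.2) (ν.prod (fieldMeasure P (j+1) U1))) := by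
      rw [hΨ.map_eq]; exact hF.aestronglyMeasurable
    rw [← integral_map hΨ.measurable.aemeasurable hF', hΨ.map_eq]
  rw [h1, integral_prod _ hI]

/-- **THE TEST-FUNCTION FORM of *"takes the block field v out of the δ-functions"***: for a `ν`-integrable `F` and a bounded measurable `g` of the
block field, `∫ν F(u) g(Qu) = ∫dv g(v) ∫ν F(u′·Q^{s*}v)` — integrated against `δ(v/Qu) dv`, the `u`-integral of `F` becomes, for every `v`, the
`ν`-integral of `F` over the translated configurations `u′(u)·Q^{s*}v`, and `v` is free (Haar).  Substitution-invariant probability law `ν`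
(`𝒟u`, `𝒟u δ_{Ax}(u)`), standing range. [cite: BalabanImbrieJaffe1988, (5.3.1) p.280] -/
theorem integral_mul_comp_qU_eq_transl (hj : j + 1 ≤ P.m + P.K) {ν : Measure (GaugeField P j U1)} [IsProbabilityMeasure ν]
    (hν : ∀ w, ν.map (fun U => surfMul U w) = ν) {F : GaugeField P j U1 → ℂ} (hF : Integrable F ν)
    {g : GaugeField P (j+1) U1 → ℂ} (hg : Measurable g) {C : ℝ} (hC : ∀ v, ‖g v‖ ≤ C) :
    ∫ U, F U * g (qU U) ∂ν = ∫ v, g v * ∫ U, F (surfMul (uPrime U) v) ∂ν ∂fieldMeasure P (j+1) U1 := by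
  have hΨ := measurePreserving_transl hj hν
  have hFg : Integrable (fun U => F U * g (qU U)) ν :=
    hF.mul_bdd (hg.comp measurable_qU).aestronglyMeasurable (Filter.Eventually.of_forall fun U => hC _)
  have hI : Integrable (fun p : GaugeField P j U1 × GaugeField P (j+1) U1 => F (surfMul (uPrime p.1) p.2) * g p.2)
      (ν.prod (fieldMeasure P (j+1) U1)) :=
    ((hΨ.integrable_comp hF.aestronglyMeasurable).2 hF).mul_bdd (hg.comp measurable_snd).aestronglyMeasurable
      (Filter.Eventually.of_forall fun p => hC _)
  have h1 : ∫ U, F U * g (qU U) ∂ν =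
      ∫ p, F (surfMul (uPrime p.1) p.2) * g (qU (surfMul (uPrime p.1) p.2)) ∂ν.prod (fieldMeasure P (j+1) U1) := by
    have hm : AEStronglyMeasurable (fun U => F U * g (qU U)) (Measure.map (fun p : GaugeField P j U1 × GaugeField P (j+1) U1 =>
        surfMul (uPrime p.1) p.2) (ν.prod (fieldMeasure P (j+1) U1))) := by
      rw [hΨ.map_eq]; exact hFg.aestronglyMeasurable
    rw [← integral_map hΨ.measurable.aemeasurable hm, hΨ.map_eq]
  rw [h1]
  simp only [qU_surfMul_uPrime hj]
  rw [integral_prod_symm _ hI]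
  refine integral_congr_ae (ae_of_all _ fun v => ?_)
  show ∫ U, F (surfMul (uPrime U) v) * g v ∂ν = g v * ∫ U, F (surfMul (uPrime U) v) ∂ν
  rw [integral_mul_const, mul_comm]

/-! ## §6 The instances of record: `ν = 𝒟u` and `ν = 𝒟u δ_{Ax}(u)` -/

/-- **Under `𝒟u`: `law(u′, Qu) = law(u′) ⊗ dv`** (r18's `map_surfMul_fieldMeasure` feeds `map_graph_eq_prod`). [cite: BalabanImbrieJaffe1988, (3.24) p.269] -/
theorem map_graph_fieldMeasure (hj : j + 1 ≤ P.m + P.K) :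
    (fieldMeasure P j U1).map (fun U => (uPrime U, qU U)) = ((fieldMeasure P j U1).map uPrime).prod (fieldMeasure P (j+1) U1) :=
  map_graph_eq_prod hj map_surfMul_fieldMeasure

/-- **Under `𝒟u δ_{Ax}(u)` (the measure of (3.11)/(5.1.1) with (5.1.4)): `law(u′, Qu) = law(u′) ⊗ dv`** (`axialMeasure_map_surfMul` feeds
`map_graph_eq_prod`). [cite: BalabanImbrieJaffe1988, (5.3.1) p.280] -/
theorem map_graph_axialMeasure (hj : j + 1 ≤ P.m + P.K) :
    (axialMeasure P j U1).map (fun U => (uPrime U, qU U)) = ((axialMeasure P j U1).map uPrime).prod (fieldMeasure P (j+1) U1) :=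
  map_graph_eq_prod hj axialMeasure_map_surfMul

/-- **Under `𝒟u`: `∫𝒟u F(u) = ∫𝒟u ∫dv F(u′·Q^{s*}v)`** (`F` integrable). [cite: BalabanImbrieJaffe1988, (3.24) p.269] -/
theorem integral_fieldMeasure_eq_transl (hj : j + 1 ≤ P.m + P.K) {E : Type*} [NormedAddCommGroup E] [NormedSpace ℝ E]
    {F : GaugeField P j U1 → E} (hF : Integrable F (fieldMeasure P j U1)) :
    ∫ U, F U ∂fieldMeasure P j U1 = ∫ U, ∫ v, F (surfMul (uPrime U) v) ∂fieldMeasure P (j+1) U1 ∂fieldMeasure P j U1 :=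
  integral_eq_transl hj map_surfMul_fieldMeasure hF

/-- **Under `𝒟u δ_{Ax}(u)`: `∫𝒟u δ_{Ax}(u) F(u) = ∫𝒟u δ_{Ax}(u) ∫dv F(u′·Q^{s*}v)`** (`F` integrable). [cite: BalabanImbrieJaffe1988, (5.3.1) p.280] -/
theorem integral_axialMeasure_eq_transl (hj : j + 1 ≤ P.m + P.K) {E : Type*} [NormedAddCommGroup E] [NormedSpace ℝ E]
    {F : GaugeField P j U1 → E} (hF : Integrable F (axialMeasure P j U1)) :
    ∫ U, F U ∂axialMeasure P j U1 = ∫ U, ∫ v, F (surfMul (uPrime U) v) ∂fieldMeasure P (j+1) U1 ∂axialMeasure P j U1 :=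
  integral_eq_transl hj axialMeasure_map_surfMul hF

/-- **Under `𝒟u δ_{Ax}(u)`, against a bounded measurable `g(v)`: `∫𝒟u δ_{Ax}(u) F(u) g(Qu) = ∫dv g(v) ∫𝒟u δ_{Ax}(u) F(u′·Q^{s*}v)`** — the
`δ(v/Qu)` of (3.11)/(5.1.1) after the translation (5.3.1), whole torus. [cite: BalabanImbrieJaffe1988, (5.3.6) p.280] -/
theorem integral_mul_comp_qU_axialMeasure (hj : j + 1 ≤ P.m + P.K) {F : GaugeField P j U1 → ℂ} (hF : Integrable F (axialMeasure P j U1))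
    {g : GaugeField P (j+1) U1 → ℂ} (hg : Measurable g) {C : ℝ} (hC : ∀ v, ‖g v‖ ≤ C) :
    ∫ U, F U * g (qU U) ∂axialMeasure P j U1 =
      ∫ v, g v * ∫ U, F (surfMul (uPrime U) v) ∂axialMeasure P j U1 ∂fieldMeasure P (j+1) U1 :=
  integral_mul_comp_qU_eq_transl hj axialMeasure_map_surfMul hF hg hC

end

end Literature.MathematicalPhysics.QuantumFieldTheory.BalabanImbrieJaffe1984to88.BIJ88Eq531TranslLaw
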